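import Literature.NumberTheory.EllipticCurves.SelmerPInftyRestriction
import Literature.NumberTheory.EllipticCurves.SelmerPInftyGaloisAction
import Literature.NumberTheory.EllipticCurves.IsogenyVariableChangeProofs
import Literature.NumberTheory.EllipticCurves.ShaPrimaryIsogenyProofs
import Literature.NumberTheory.QuadraticFields.SquareRootGenerator
import HarnessLib

/-!
# Exact descent of `Ш` along `ℚ(ζ₃)/ℚ` for elliptic curves with `j = 0`

For `E : y² = x³ + B` over `ℚ` (a short Weierstrass model with `a₁ = a₂ = a₃ = a₄ = 0`, i.e.
`j = 0`, complex multiplication by `ℤ[ω]`) and a quadratic number field `K` containing a primitive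
cube root of unity (`K ≅ ℚ(ω) = ℚ(√−3)`), the restriction map on Galois cohomology
`H¹(ℚ, E) → H¹(K, E_K)` (`Literature.NumberTheory.EllipticCurves.resBaseChange`) is INJECTIVE, hence so
is `Ш(E/ℚ) → Ш(E_K/K)` (`Literature.NumberTheory.EllipticCurves.shaRestriction`) — with NO
`2`-torsion error, although `[K : ℚ] = 2` (compare `ShaRestrictionIndex`: in general the kernel is
only killed by `[K : ℚ]`). The kernel is `H¹(Gal(K/ℚ), E(K))` (inflation–restriction), and this
group vanishes because `E(K)` is a `ℤ[ω]`-module on which complex conjugation acts SEMILINEARLY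
and `ω` has trace `−1`: for `P ∈ E(K)` with `P̄ = −P` the point `Q := [ω]P` satisfies
`Q̄ − Q = [ω̄](−P) − [ω]P = −([ω²] + [ω])P = P`. (For `ℤ[i]` every trace is even and the analogous
statement fails in general: `2` must be UNRAMIFIED in the CM field.) This is the descent step
«`Ш(E/ℚ)[2] ↪ Ш(E/K)[2]`» used for the cube-sum curves `E_p : x³ + y³ = p` over `K = ℚ(ω)`
(Hu–Shu–Yin 2019; cf. Gross 1991 §5 (5.1) `Ш(E/K)^±` in the Heegner setting, where `p` odd is
needed instead).

## Main statements

* `inflClass_eq_zero_of_index_two_of_witness` — generic continuous cohomology: a crossed homomorphism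
  vanishing on a normal subgroup of index `2` with a «half-coboundary witness» is a coboundary.
* `JZero.exists_cm_coboundary_witness` — the witness `Q = [ω]P = (ζ'²x_P, y_P)` on `y² = x³ + B`
  (the trace identity `(ζx, y) + (ζ²x, y) + (x, y) = O` on a horizontal line).
* `JZero.resBaseChange_injective_of_isPrimitiveRoot`, `JZero.shaRestriction_injective_of_isPrimitiveRoot`
  — injectivity of `H¹(ℚ, E) → H¹(K, E_K)` and of `Ш(E/ℚ) → Ш(E_K/K)`.
* `JZero.natCard_primaryComponent_sha_eq_one_of_baseChange` (`Ш(E_K/K)[ℓ^∞] = 0 ⇒ Ш(E/ℚ)[ℓ^∞] = 0`),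
  `natCard_primaryComponent_sha_eq_of_variableChange` (MODEL TRANSPORT: `ℚ`-isomorphic models have
  the same `#Ш[ℓ^∞]`, via the degree-`1` isogeny `VariableChange.toIsogeny`), and the assembled
  `JZero.natCard_primaryComponent_sha_eq_one_of_variableChange_of_baseChange`.
* `conjH1Points_resBaseChange`, `conjH1Points_shaRestriction` — for ANY `E/ℚ`, any number field
  `K` and any lift `τ` of any `σ ∈ Aut(K/ℚ)`: `τ_* ∘ res = res` (`res` lands in the
  `Gal(K/ℚ)`-invariants; the two compatible pairs differ by an inner pair of `Γ_ℚ`).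
* §6, the binder convention `(K, ω, ω² + ω + 1 = 0, [K : ℚ] = 2)` of
  `HuShuYin2019.shaAnPair_mul_height_eq_two_zpow_mul_height`: `JZero.exists_aut_apply_eq_sq`
  (`ω` is a primitive cube root of unity, complex conjugation `σ` with `σ ω = ω²`, `σ² = 1`, `K`
  totally complex), and the hypothesis-free forms `JZero.shaRestriction_injective`,
  `JZero.natCard_primaryComponent_sha_eq_one_of_variableChange`.

## Design notes

Everything is proved; no definition, no instance, no named fact. The horizontal-line identities of
§2 are the canonical Literature home of an elementary group-law computation (Silverman III.2.3) —
the problem-side tree has a copy it cannot export here (Literature never imports `Summits`). The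
surjectivity of `res` onto the invariants (giving `#Ш(E_K/K)[2^∞] = #Ш(E/ℚ)[2^∞]²` together with
the `ℤ[ω]`-module structure) is NOT here.

## References

* J.-P. Serre, *Galois Cohomology* (1997), I.§2.4 (Prop. 9 and Cor.), I.§5.8.
  [SerreGaloisCohomology1997]
* J.-P. Serre, *Local Fields* (1979), VII.§5 Prop. 3 (inner automorphisms act trivially).
  [SerreLocalFields1979]
* B. H. Gross, *Kolyvagin's work on modular elliptic curves*, LMS LNS 153 (1991), §5 (5.1).
  [GrossLMS1991]
* J. H. Silverman, *The Arithmetic of Elliptic Curves*, 2nd ed. (2009), III.2.3, Thm. III.10.1,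
  Cor. III.10.2, III.3.1(b), X.§4. [SilvermanAEC2009]
* J. S. Milne, *Arithmetic Duality Theorems*, 2nd ed. (2006), I.§6, Lemma I.7.1(b). [MilneADT2006]
* Y. Hu, J. Shu, H. Yin, *An explicit Gross–Zagier formula related to the Sylvester conjecture*,
  Trans. AMS 372 (2019), §1 (the curves `E_p`, `E_{3p²}` over `K = ℚ(√−3) ∋ ω`). [HuShuYin2019]
-/

set_option autoImplicit false

noncomputable section

open scoped Classical

universe u

open WeierstrassCurve Literature.NumberTheory.EllipticCurves
  Literature.NumberTheory.GaloisRepresentations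

namespace Literature.NumberTheory.EllipticCurves

/-! ## §1 Index two: an inflated crossed homomorphism with a half-coboundary witness is a coboundary -/

section IndexTwo

variable {G : Type u} [Group G] [TopologicalSpace G] [IsTopologicalGroup G]
variable {M : Type u} [AddCommGroup M] [DistribMulAction G M] [TopologicalSpace M]
  [DiscreteTopology M]

/-- **Index two.** Let `N ≤ G` be an open subgroup with `G = N ∪ N g₀` and let `f : G → M` be a
crossed homomorphism vanishing on `N` (so `f` is the inflation of a `1`-cocycle of `G/N ≅ C₂` with
values in `M^N`, determined by the single value `f g₀`). If some `Q ∈ M` is fixed by `N` and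
satisfies `g₀ Q − Q = f g₀`, then `f = ∂Q` and the inflated class `[f] ∈ H¹_cont(G, M)` vanishes:
for `n ∈ N`, `f n = 0 = n Q − Q`; for `g = n g₀`, `f g = n • f g₀ = f g₀` and
`g Q − Q = n (Q + f g₀) − Q = f g₀`. (The class of `f g₀` in `H¹(C₂, M^N) = ker(1+g₀)/im(g₀−1)`
is zero.) Serre, *Galois Cohomology*, I.§2.4 and I.§5.8 (inflation–restriction; `H¹` of a cyclic
group of order `2`). [cite: SerreGaloisCohomology1997, I.§2.4 (Prop. 9 and Cor.) and I.§5.8] -/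
theorem inflClass_eq_zero_of_index_two_of_witness (N : Subgroup G) [N.Normal] (hN : IsOpen (N : Set G))
    (f : cocyclesVanishingOn M N) {g₀ : G} (hcoset : ∀ g : G, g ∈ N ∨ g * g₀⁻¹ ∈ N) (Q : M)
    (hQN : ∀ n ∈ N, n • Q = Q) (hQ : g₀ • Q - Q = f.1 g₀) : inflClass M N hN f = 0 := by
  rw [inflClass_apply, oneCocycleClass_eq_zero_iff]
  refine ⟨Q, fun g ↦ ?_⟩
  rw [discreteTopRep_ρ_apply, toContOneCocycle_apply]
  rcases hcoset g with hg | hg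
  · rw [cocyclesVanishingOn.apply_of_mem f hg, hQN g hg, sub_self]
  · -- `g = (g g₀⁻¹) g₀` with `g g₀⁻¹ ∈ N`
    have hval : ∀ n ∈ N, n • f.1 g₀ = f.1 g₀ := fun n hn ↦ cocyclesVanishingOn.smul_apply f g₀ hn
    have e : g = g * g₀⁻¹ * g₀ := by rw [inv_mul_cancel_right]
    have h1 : f.1 g = f.1 g₀ := by
      rw [e, cocyclesVanishingOn.apply_of_mem_mul f g₀ hg, hval _ hg]
    have h2 : g • Q = Q + f.1 g₀ := by
      conv_lhs => rw [e, mul_smul]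
      have h3 : g₀ • Q = Q + f.1 g₀ := by rw [← hQ]; abel
      rw [h3, smul_add, hQN _ hg, hval _ hg]
    rw [h1, h2, add_sub_cancel_left]

end IndexTwo

/-! ## §2a The group law on a horizontal line of `y² = x³ + a₆` (Silverman III.2.3) -/

section HorizontalLine

variable {F : Type u} [Field F] {W : Affine F}

/-- On `y² = x³ + a₆` (all of `a₁, a₂, a₃, a₄` zero) two affine points with the SAME ordinate `y`
and abscissae `x₁ ≠ x₂` add up to `-(x₃, y)` whenever `x₁ + x₂ + x₃ = 0` and `(x₃, y)` is on the
curve (the chord is horizontal; its third intersection has abscissa `-a₂ - x₁ - x₂ = x₃`).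
Silverman, *AEC*, III.2.3 (group law algorithm). [folklore] -/
private theorem horizontal_some_add_some (ha₁ : W.a₁ = 0) (ha₂ : W.a₂ = 0) (ha₃ : W.a₃ = 0)
    {x₁ x₂ x₃ y : F} (h₁ : W.Nonsingular x₁ y) (h₂ : W.Nonsingular x₂ y) (h₃ : W.Nonsingular x₃ y)
    (hx : x₁ ≠ x₂) (hsum : x₁ + x₂ + x₃ = 0) :
    Affine.Point.some x₁ y h₁ + Affine.Point.some x₂ y h₂ = -Affine.Point.some x₃ y h₃ := by
  have hL : W.slope x₁ x₂ y y = 0 := by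
    rw [Affine.slope_of_X_ne hx, sub_self, zero_div]
  rw [Affine.Point.add_of_X_ne hx, Affine.Point.neg_some]
  congr 1
  · rw [hL]
    simp only [Affine.addX, ha₁, ha₂]
    linear_combination -hsum
  · rw [hL]
    simp [Affine.addY, Affine.negAddY, Affine.negY, Affine.addX, ha₁, ha₃]

/-- On `y² = x³ + a₆` (all of `a₁, a₂, a₃, a₄` zero) with `2y ≠ 0`, the affine point `(0, y)` is a
flex: `2·(0, y) = -(0, y)` (the tangent is horizontal). Silverman, *AEC*, III.2.3. [folklore] -/
private theorem horizontal_some_zero_add_self (ha₁ : W.a₁ = 0) (ha₂ : W.a₂ = 0) (ha₃ : W.a₃ = 0)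
    (ha₄ : W.a₄ = 0) {y : F} (hy0 : (2 : F) * y ≠ 0) (h : W.Nonsingular 0 y) :
    Affine.Point.some 0 y h + Affine.Point.some 0 y h = -Affine.Point.some 0 y h := by
  have hy : y ≠ W.negY 0 y := by
    intro e
    apply hy0
    have e' : y = -y - W.a₁ * 0 - W.a₃ := e
    rw [ha₃] at e'
    linear_combination e'
  have hL : W.slope 0 0 y y = 0 := by
    rw [Affine.slope_of_Y_ne rfl hy]
    simp [Affine.negY, ha₁, ha₂, ha₄]
  rw [Affine.Point.add_self_of_Y_ne hy, Affine.Point.neg_some]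
  congr 1
  · rw [hL]
    simp [Affine.addX, ha₁, ha₂]
  · rw [hL]
    simp [Affine.addY, Affine.negAddY, Affine.negY, Affine.addX, ha₁, ha₂, ha₃]

/-- **The trace identity `[ζ²] + [ζ] + 1 = 0` on a horizontal line.** On `y² = x³ + a₆` (all of
`a₁, a₂, a₃, a₄` zero) over a field with `2 ≠ 0`, for `ζ ≠ 1` with `ζ³ = 1` and an affine point
`(x, y)`: `(ζx, y) + (ζ²x, y) = -(x, y)` (for `x ≠ 0` the three points `(x,y), (ζx,y), (ζ²x,y)` are
the intersections with the horizontal line `Y = y`; for `x = 0` they coincide with the flex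
`(0, y)`). Silverman, *AEC*, III.2.3 and Thm. III.10.1 (`Aut E ≅ μ₆` for `j = 0`).
[cite: SilvermanAEC2009, Thm. III.10.1 and Cor. III.10.2] -/
theorem horizontal_some_add_some_eq_neg (ha₁ : W.a₁ = 0) (ha₂ : W.a₂ = 0) (ha₃ : W.a₃ = 0)
    (ha₄ : W.a₄ = 0) {ζ : F} (h2 : (2 : F) ≠ 0) (hζ3 : ζ ^ 3 = 1) (hζ1 : ζ ≠ 1) {x y : F}
    (h₀ : W.Nonsingular x y) (h₁ : W.Nonsingular (ζ * x) y) (h₂ : W.Nonsingular (ζ ^ 2 * x) y) :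
    Affine.Point.some (ζ * x) y h₁ + Affine.Point.some (ζ ^ 2 * x) y h₂ =
      -Affine.Point.some x y h₀ := by
  have hζ : ζ ^ 2 + ζ + 1 = 0 := by
    have hprod : (ζ - 1) * (ζ ^ 2 + ζ + 1) = 0 := by linear_combination hζ3
    rcases mul_eq_zero.mp hprod with h | h
    · exact absurd (sub_eq_zero.mp h) hζ1
    · exact h
  by_cases hx : x = 0
  · subst hx
    have hy0 : (2 : F) * y ≠ 0 := by
      refine mul_ne_zero h2 fun hy ↦ ?_
      subst hy
      rw [Affine.nonsingular_iff'] at h₀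
      simp [ha₁, ha₂, ha₃, ha₄] at h₀
    have e₁ : Affine.Point.some (ζ * 0) y h₁ = Affine.Point.some 0 y h₀ := by congr 1; simp
    have e₂ : Affine.Point.some (ζ ^ 2 * 0) y h₂ = Affine.Point.some 0 y h₀ := by congr 1; simp
    rw [e₁, e₂, horizontal_some_zero_add_self ha₁ ha₂ ha₃ ha₄ hy0 h₀]
  · have hζ0 : ζ ≠ 0 := by
      intro e; subst e; simp at hζ
    have hx12 : ζ * x ≠ ζ ^ 2 * x := by
      intro e
      have : ζ * (ζ - 1) * x = 0 := by linear_combination -e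
      rcases mul_eq_zero.mp this with h | h
      · rcases mul_eq_zero.mp h with h' | h'
        · exact hζ0 h'
        · exact hζ1 (sub_eq_zero.mp h')
      · exact hx h
    exact horizontal_some_add_some ha₁ ha₂ ha₃ h₁ h₂ h₀ hx12 (by linear_combination x * hζ)

end HorizontalLine

/-! ## §2 The CM line: the coboundary witness `Q = [ω]P` on `y² = x³ + B` over `ℚ` -/

namespace JZero

section CMWitness

variable (W : WeierstrassCurve ℚ) [W.IsElliptic]

omit [W.IsElliptic] in
/-- The `Γ_ℚ`-action on an affine geometric point is coordinatewise (Mathlib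
`Affine.Point.map_some`, definitionally). Silverman, *AEC*, VIII.§1. [folklore] -/
private theorem geomPoints_smul_some_eq (g : Field.absoluteGaloisGroup ℚ) {x y : AlgebraicClosure ℚ}
    (h : (W.baseChange (AlgebraicClosure ℚ)).toAffine.Nonsingular x y) :
    ∃ h', @HSMul.hSMul (Field.absoluteGaloisGroup ℚ) (geomPoints W) (geomPoints W) instHSMul g
        (Affine.Point.some x y h) =
      Affine.Point.some ((show AlgebraicClosure ℚ ≃ₐ[ℚ] AlgebraicClosure ℚ from g) x)
        ((show AlgebraicClosure ℚ ≃ₐ[ℚ] AlgebraicClosure ℚ from g) y) h' :=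
  ⟨_, rfl⟩

/-- On an elliptic `j = 0` short model `y² = x³ + B` over `ℚ` (all of `a₁, …, a₄` zero) every
solution of the equation over `ℚ̄` is a nonsingular point, and the equation is stable under
`(x, y) ↦ (ζ'x, y)` for `ζ'³ = 1` and under `y ↦ −y`. Silverman, *AEC*, III.1 and III.10.1.
[folklore] -/
private theorem nonsingular_cubeRoot_mul (ha₁ : W.a₁ = 0) (ha₂ : W.a₂ = 0) (ha₃ : W.a₃ = 0)
    (ha₄ : W.a₄ = 0) {ζ' : AlgebraicClosure ℚ} (hζ'3 : ζ' ^ 3 = 1) {x y : AlgebraicClosure ℚ}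
    (h : (W.baseChange (AlgebraicClosure ℚ)).toAffine.Nonsingular x y) (k : ℕ) (ε : ℤˣ) :
    (W.baseChange (AlgebraicClosure ℚ)).toAffine.Nonsingular (ζ' ^ k * x) ((ε : ℤ) • y) := by
  haveI : (W.baseChange (AlgebraicClosure ℚ)).IsElliptic := by
    rw [WeierstrassCurve.baseChange]; infer_instance
  have hb₁ : (W.baseChange (AlgebraicClosure ℚ)).a₁ = 0 := by simp [WeierstrassCurve.baseChange, ha₁]
  have hb₂ : (W.baseChange (AlgebraicClosure ℚ)).a₂ = 0 := by simp [WeierstrassCurve.baseChange, ha₂]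
  have hb₃ : (W.baseChange (AlgebraicClosure ℚ)).a₃ = 0 := by simp [WeierstrassCurve.baseChange, ha₃]
  have hb₄ : (W.baseChange (AlgebraicClosure ℚ)).a₄ = 0 := by simp [WeierstrassCurve.baseChange, ha₄]
  rw [← Affine.equation_iff_nonsingular] at h ⊢
  rw [Affine.equation_iff'] at h ⊢
  simp only [hb₁, hb₂, hb₃, hb₄, zero_mul, add_zero] at h ⊢
  have hε : ((ε : ℤ) : AlgebraicClosure ℚ) ^ 2 = 1 := by
    rcases Int.units_eq_one_or ε with rfl | rfl <;> simp
  have hζk : (ζ' ^ k) ^ 3 = 1 := by rw [← pow_mul, mul_comm, pow_mul, hζ'3, one_pow]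
  rw [zsmul_eq_mul]
  linear_combination h + y ^ 2 * hε - x ^ 3 * hζk

/-- **The coboundary witness `Q = [ω]P`** (the CM-specific line of the descent). `E : y² = x³ + B`
over `ℚ` (elliptic, all of `a₁, …, a₄` zero), `ζ' ∈ ℚ̄` a primitive cube root of unity, `P ∈ E(ℚ̄)`.
Then `Q := (ζ'²x_P, y_P)` (and `Q := O` for `P = O`) satisfies: (i) `g Q = Q` for every `g ∈ Γ_ℚ`
fixing `ζ'` and `P`; (ii) `g Q − Q = P` for every `g ∈ Γ_ℚ` with `g ζ' = ζ'²` and `g P = −P` —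
indeed `g Q = (ζ'⁴x, −y) = (ζ'x, −y)` and `(ζ'x, −y) + (ζ'²x, −y) + (x, −y) = O` (the trace identity
`[ω²] + [ω] + 1 = 0`, `horizontal_some_add_some_eq_neg`), i.e. `g Q − Q = −(x, −y) = P`.
Silverman, *AEC*, III.10.1 (`Aut E ≅ μ₆` for `j = 0`); this is the descent along the unramified
quadratic extension `ℤ₂[ω]/ℤ₂` of coefficient rings. [cite: SilvermanAEC2009, Thm. III.10.1 and Cor. III.10.2] -/
theorem exists_cm_coboundary_witness (ha₁ : W.a₁ = 0) (ha₂ : W.a₂ = 0) (ha₃ : W.a₃ = 0)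
    (ha₄ : W.a₄ = 0) {ζ' : AlgebraicClosure ℚ} (hζ'3 : ζ' ^ 3 = 1) (hζ'1 : ζ' ≠ 1)
    (P : geomPoints W) :
    ∃ Q : geomPoints W,
      (∀ g : Field.absoluteGaloisGroup ℚ,
        (show AlgebraicClosure ℚ ≃ₐ[ℚ] AlgebraicClosure ℚ from g) ζ' = ζ' → g • P = P →
          g • Q = Q) ∧
      ∀ g : Field.absoluteGaloisGroup ℚ,
        (show AlgebraicClosure ℚ ≃ₐ[ℚ] AlgebraicClosure ℚ from g) ζ' = ζ' ^ 2 → g • P = -P →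
          g • Q - Q = P := by
  have hb₁ : (W.baseChange (AlgebraicClosure ℚ)).a₁ = 0 := by simp [WeierstrassCurve.baseChange, ha₁]
  have hb₂ : (W.baseChange (AlgebraicClosure ℚ)).a₂ = 0 := by simp [WeierstrassCurve.baseChange, ha₂]
  have hb₃ : (W.baseChange (AlgebraicClosure ℚ)).a₃ = 0 := by simp [WeierstrassCurve.baseChange, ha₃]
  have hb₄ : (W.baseChange (AlgebraicClosure ℚ)).a₄ = 0 := by simp [WeierstrassCurve.baseChange, ha₄]
  have h2 : (2 : AlgebraicClosure ℚ) ≠ 0 := two_ne_zero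
  have hζ4 : ζ' ^ 2 * ζ' ^ 2 = ζ' := by
    linear_combination ζ' * hζ'3
  change (W.baseChange (AlgebraicClosure ℚ)).toAffine.Point at P
  rcases P with _ | ⟨x, y, h⟩
  · refine ⟨0, fun g _ _ ↦ smul_zero g, fun g _ _ ↦ ?_⟩
    change g • (0 : geomPoints W) - 0 = 0
    rw [smul_zero, sub_zero]
  · -- the rotated points are on the curve
    have h₂ : (W.baseChange (AlgebraicClosure ℚ)).toAffine.Nonsingular (ζ' ^ 2 * x) y := by
      simpa using nonsingular_cubeRoot_mul W ha₁ ha₂ ha₃ ha₄ hζ'3 h 2 1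
    have h₀' : (W.baseChange (AlgebraicClosure ℚ)).toAffine.Nonsingular x (-y) := by
      simpa using nonsingular_cubeRoot_mul W ha₁ ha₂ ha₃ ha₄ hζ'3 h 0 (-1)
    have h₁' : (W.baseChange (AlgebraicClosure ℚ)).toAffine.Nonsingular (ζ' * x) (-y) := by
      simpa using nonsingular_cubeRoot_mul W ha₁ ha₂ ha₃ ha₄ hζ'3 h 1 (-1)
    have h₂' : (W.baseChange (AlgebraicClosure ℚ)).toAffine.Nonsingular (ζ' ^ 2 * x) (-y) := by
      simpa using nonsingular_cubeRoot_mul W ha₁ ha₂ ha₃ ha₄ hζ'3 h 2 (-1)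
    refine ⟨Affine.Point.some (ζ' ^ 2 * x) y h₂, fun g hgζ hgP ↦ ?_, fun g hgζ hgP ↦ ?_⟩
    · -- (i) `g` fixes `ζ'` and `P`
      obtain ⟨h', e'⟩ := geomPoints_smul_some_eq W g h
      obtain ⟨h'', e''⟩ := geomPoints_smul_some_eq W g h₂
      have hxy : (Affine.Point.some _ _ h' : (W.baseChange (AlgebraicClosure ℚ)).toAffine.Point) =
          Affine.Point.some x y h := e'.symm.trans hgP
      rw [Affine.Point.some.injEq] at hxy
      exact e''.trans (Affine.Point.some_eq_some_of_eq (by rw [map_mul, map_pow, hgζ, hxy.1]) hxy.2)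
    · -- (ii) `g ζ' = ζ'²` and `g P = -P`
      obtain ⟨h', e'⟩ := geomPoints_smul_some_eq W g h
      obtain ⟨h'', e''⟩ := geomPoints_smul_some_eq W g h₂
      have hxy : (Affine.Point.some _ _ h' : (W.baseChange (AlgebraicClosure ℚ)).toAffine.Point) =
          Affine.Point.some x ((W.baseChange (AlgebraicClosure ℚ)).toAffine.negY x y)
            ((Affine.nonsingular_neg ..).mpr h) := e'.symm.trans hgP
      rw [Affine.Point.some.injEq] at hxy
      have hy : (show AlgebraicClosure ℚ ≃ₐ[ℚ] AlgebraicClosure ℚ from g) y = -y := by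
        rw [hxy.2]; simp [Affine.negY, ha₁, ha₃]
      -- `g Q = (ζ' x, -y)`
      have hgQ : @HSMul.hSMul (Field.absoluteGaloisGroup ℚ) (geomPoints W) (geomPoints W)
          instHSMul g (Affine.Point.some (ζ' ^ 2 * x) y h₂) =
            Affine.Point.some (ζ' * x) (-y) h₁' :=
        e''.trans (Affine.Point.some_eq_some_of_eq
          (by rw [map_mul, map_pow, hgζ, hxy.1, ← pow_mul]; linear_combination x * ζ' * hζ'3) hy)
      -- `-Q = (ζ'² x, -y)`
      have hnegQ : @Neg.neg (geomPoints W) _ (Affine.Point.some (ζ' ^ 2 * x) y h₂) =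
          Affine.Point.some (ζ' ^ 2 * x) (-y) h₂' := by
        change Affine.Point.some (ζ' ^ 2 * x)
          ((W.baseChange (AlgebraicClosure ℚ)).toAffine.negY (ζ' ^ 2 * x) y) _ = _
        exact Affine.Point.some_eq_some_of_eq rfl (by simp [Affine.negY, ha₁, ha₃])
      -- `P = -(x, -y)`
      have hP : @Neg.neg (geomPoints W) _ (Affine.Point.some x (-y) h₀') =
          Affine.Point.some x y h := by
        change Affine.Point.some x ((W.baseChange (AlgebraicClosure ℚ)).toAffine.negY x (-y)) _ = _
        exact Affine.Point.some_eq_some_of_eq rfl (by simp [Affine.negY, ha₁, ha₃])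
      have key := horizontal_some_add_some_eq_neg hb₁ hb₂ hb₃ hb₄ h2 hζ'3 hζ'1 h₀' h₁' h₂'
      rw [sub_eq_add_neg]
      refine (congrArg₂ (· + ·) hgQ hnegQ).trans ?_
      rw [← hP]
      exact key

end CMWitness

/-! ## §3 Injectivity of `H¹(ℚ, E) → H¹(K, E_K)` and of `Ш(E/ℚ) → Ш(E_K/K)` for `K = ℚ(ω)` -/

section Descent

variable (W : WeierstrassCurve ℚ) [W.IsElliptic] (K : Type) [Field K] [NumberField K]

/-- `σ ζ = ζ²` for a primitive cube root of unity forces `σ ≠ 1` (`ζ² ≠ ζ`). [folklore] -/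
private theorem algEquiv_ne_one_of_apply_eq_sq {ζ : K} (hζ : IsPrimitiveRoot ζ 3) {σ : K ≃ₐ[ℚ] K}
    (hσζ : σ ζ = ζ ^ 2) : σ ≠ 1 := by
  intro h
  rw [h, AlgEquiv.one_apply] at hσζ
  have hζ0 : ζ ≠ 0 := hζ.ne_zero (by norm_num)
  have hζ1 : ζ ≠ 1 := hζ.ne_one (by norm_num)
  have : ζ * (ζ - 1) = 0 := by linear_combination hσζ.symm
  rcases mul_eq_zero.mp this with h0 | h0
  · exact hζ0 h0
  · exact hζ1 (sub_eq_zero.mp h0)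

/-- **EXACT DESCENT of `H¹` along `ℚ(ω)/ℚ` for a `j = 0` short model** (Hu–Shu–Yin's frame
`K = ℚ(√−3)`; Gross 1991 §5 for the Heegner analogue). `E = W/ℚ` elliptic with all of
`a₁, …, a₄` zero (`y² = x³ + B`), `K` a quadratic number field containing a primitive cube root of unity `ζ` (so `K ≅ ℚ(ω)`), `σ ∈ Aut(K/ℚ)` with `σ ζ = ζ²`.
Then the restriction `H¹(ℚ, E) → H¹(K, E_K)`
(`Literature.NumberTheory.EllipticCurves.resBaseChange`) is INJECTIVE. Proof: a kernel class is
inflated from a crossed homomorphism `f` on `Γ_ℚ` vanishing on the index-`2` open normal subgroup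
`Γ_K = galRange K` (`resKer_le_range_inflClass`); with `g₀` the transported lift of `σ`
(`liftToAbsGal`, `g₀ ∉ Γ_K`, `g₀ ζ' = ζ'²` on the embedded `ζ' = j(ζ)`), `P := f g₀` is fixed by
`Γ_K` and `g₀ P = −P` (`f(g₀²) = 0`), and `Q := [ω]P` is a coboundary witness
(`exists_cm_coboundary_witness`), so `[f] = 0` (`inflClass_eq_zero_of_index_two_of_witness`). In words:
`H¹(Gal(K/ℚ), E(K)) = 0` because `E(K)` is a `ℤ[ω]`-module on which complex conjugation is
semilinear and `ω` has trace `−1`. Serre, *Galois Cohomology*, I.§5.8; Gross 1991 §5 (5.1);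
Silverman *AEC* III.10.1. [cite: SerreGaloisCohomology1997, I.§2.4 (Prop. 9 and Cor.) and I.§5.8]
[cite: SilvermanAEC2009, Thm. III.10.1 and Cor. III.10.2] -/
theorem resBaseChange_injective_of_isPrimitiveRoot (ha₁ : W.a₁ = 0) (ha₂ : W.a₂ = 0)
    (ha₃ : W.a₃ = 0) (ha₄ : W.a₄ = 0) (h2 : Module.finrank ℚ K = 2) {ζ : K}
    (hζ : IsPrimitiveRoot ζ 3) {σ : K ≃ₐ[ℚ] K} (hσζ : σ ζ = ζ ^ 2) :
    Function.Injective (resBaseChange W K) := by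
  haveI : IsGalois ℚ K := by
    haveI : Algebra.IsQuadraticExtension ℚ K := ⟨h2⟩
    infer_instance
  have hσ1 : σ ≠ 1 := algEquiv_ne_one_of_apply_eq_sq K hζ hσζ
  haveI hNn : (galRange (K := ℚ) K).Normal := normal_galRange K h2 hσ1
  rw [injective_iff_map_eq_zero]
  intro c hc
  rw [mem_ker_resBaseChange_iff] at hc
  -- the kernel class is inflated from `Γ_ℚ / Γ_K`
  have hle := resKer_le_range_inflClass (resGal (K := ℚ) K) (pointsMap W K) (pointsMap_smul W K)
    (pointsMapOfEmb_bijective K W _) (galRange (K := ℚ) K) (isOpen_galRange K) le_rfl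
  obtain ⟨f, rfl⟩ := hle hc
  -- the transported lift `g₀` of `σ` and the embedded cube root `ζ'`
  obtain ⟨g₀, hg₀⟩ : ∃ g₀ : Field.absoluteGaloisGroup ℚ, liftToAbsGal (K := ℚ) K σ = g₀ := ⟨_, rfl⟩
  obtain ⟨ζ', hζ'⟩ : ∃ ζ' : AlgebraicClosure ℚ, embIntoClosure (K := ℚ) K ζ = ζ' := ⟨_, rfl⟩
  have hζ'3 : ζ' ^ 3 = 1 := by rw [← hζ', ← map_pow, hζ.pow_eq_one, map_one]
  have hζ'1 : ζ' ≠ 1 :=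
    (hζ' ▸ hζ.map_of_injective (embIntoClosure (K := ℚ) K).injective).ne_one (by norm_num)
  have hg₀N : g₀ ∉ galRange (K := ℚ) K := hg₀ ▸ liftToAbsGal_not_mem K hσ1
  have hcoset : ∀ g : Field.absoluteGaloisGroup ℚ,
      g ∈ galRange (K := ℚ) K ∨ g * g₀⁻¹ ∈ galRange (K := ℚ) K := fun g ↦ by
    rcases xor_galRange K h2 hσ1 g with ⟨h1, -⟩ | ⟨h1, -⟩
    · exact Or.inr (hg₀ ▸ h1)
    · exact Or.inl h1
  have hg₀2 : g₀ * g₀ ∈ galRange (K := ℚ) K := by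
    rcases xor_galRange K h2 hσ1 (g₀ * g₀) with ⟨h1, -⟩ | ⟨h1, -⟩
    · rw [hg₀, mul_inv_cancel_right] at h1
      exact absurd h1 hg₀N
    · exact h1
  -- `P := f g₀` is fixed by `Γ_K` and flipped by `g₀`
  have hPflip : g₀ • f.1 g₀ = -f.1 g₀ := by
    have e := cocyclesVanishingOn.cocycle f g₀ g₀
    rw [cocyclesVanishingOn.apply_of_mem f hg₀2] at e
    exact eq_neg_of_add_eq_zero_right e.symm
  obtain ⟨Q, hQfix, hQmove⟩ := exists_cm_coboundary_witness W ha₁ ha₂ ha₃ ha₄ hζ'3 hζ'1 (f.1 g₀)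
  refine inflClass_eq_zero_of_index_two_of_witness (galRange (K := ℚ) K) (isOpen_galRange K) f hcoset Q
    (fun n hn ↦ hQfix n ?_ (cocyclesVanishingOn.smul_apply f g₀ hn)) (hQmove g₀ ?_ hPflip)
  · rw [← hζ']
    exact smul_embIntoClosure_of_mem_galRange K hn ζ
  · rw [← hζ', ← hg₀]
    exact (liftToAbsGal_embIntoClosure (K := ℚ) K σ ζ).trans (by rw [hσζ, map_pow])

/-- **`Ш(E/ℚ) ↪ Ш(E_K/K)` for `K = ℚ(ω)` and a `j = 0` short model**: the restriction
`Literature.NumberTheory.EllipticCurves.shaRestriction W K` is injective — the descent step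
«`Ш(E/ℚ)[2] ↪ Ш(E/K)[2]`» for the cube-sum curves over `ℚ(√−3)`, on the tree's genuine `Ш`, in fact
on all of `Ш`, with no torsion error. [cite: GrossLMS1991, §5 (5.1)]
[cite: SilvermanAEC2009, Thm. III.10.1 and Cor. III.10.2] -/
theorem shaRestriction_injective_of_isPrimitiveRoot (ha₁ : W.a₁ = 0) (ha₂ : W.a₂ = 0)
    (ha₃ : W.a₃ = 0) (ha₄ : W.a₄ = 0) (h2 : Module.finrank ℚ K = 2) {ζ : K}
    (hζ : IsPrimitiveRoot ζ 3) {σ : K ≃ₐ[ℚ] K} (hσζ : σ ζ = ζ ^ 2) :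
    Function.Injective (shaRestriction W K) := by
  intro c c' h
  apply Subtype.ext
  apply resBaseChange_injective_of_isPrimitiveRoot W K ha₁ ha₂ ha₃ ha₄ h2 hζ hσζ
  rw [← coe_shaRestriction_apply, ← coe_shaRestriction_apply, h]

/-! ## §4 The currency of the stubs: `ℓ`-primary components and model transport -/

omit [W.IsElliptic] in
/-- **`Ш(E_K/K)[ℓ^∞] = 0 ⇒ Ш(E/ℚ)[ℓ^∞] = 0`** under an injective restriction (any prime `ℓ`; the
route uses `ℓ = 2`): a homomorphism maps `ℓ`-primary elements to `ℓ`-primary elements.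
[cite: MilneADT2006, Ch. I §6 p. 75] -/
theorem primaryComponent_sha_eq_bot_of_baseChange (hinj : Function.Injective (shaRestriction W K))
    (ℓ : ℕ) [Fact ℓ.Prime]
    (hK : AddCommGroup.primaryComponent (W.baseChange K).sha ℓ = ⊥) :
    AddCommGroup.primaryComponent W.sha ℓ = ⊥ := by
  rw [eq_bot_iff]
  intro c hc
  have hres : shaRestriction W K c ∈ AddCommGroup.primaryComponent (W.baseChange K).sha ℓ :=
    map_mem_primaryComponent (shaRestriction W K) hc
  rw [hK, AddSubgroup.mem_bot] at hres
  rw [AddSubgroup.mem_bot]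
  exact hinj (by rw [hres, map_zero])

/-- **`#Ш(E_K/K)[ℓ^∞] = 1 ⇒ #Ш(E/ℚ)[ℓ^∞] = 1`** for `K = ℚ(ω)` and a `j = 0` short model over `ℚ`
(`Nat.card` form).
[cite: GrossLMS1991, §5 (5.1)] [cite: SilvermanAEC2009, Thm. III.10.1 and Cor. III.10.2] -/
theorem natCard_primaryComponent_sha_eq_one_of_baseChange (ha₁ : W.a₁ = 0) (ha₂ : W.a₂ = 0)
    (ha₃ : W.a₃ = 0) (ha₄ : W.a₄ = 0) (h2 : Module.finrank ℚ K = 2) {ζ : K}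
    (hζ : IsPrimitiveRoot ζ 3) {σ : K ≃ₐ[ℚ] K} (hσζ : σ ζ = ζ ^ 2) (ℓ : ℕ) [Fact ℓ.Prime]
    (hK : Nat.card (AddCommGroup.primaryComponent (W.baseChange K).sha ℓ) = 1) :
    Nat.card (AddCommGroup.primaryComponent W.sha ℓ) = 1 := by
  rw [AddSubgroup.card_eq_one] at hK ⊢
  exact primaryComponent_sha_eq_bot_of_baseChange W K
    (shaRestriction_injective_of_isPrimitiveRoot W K ha₁ ha₂ ha₃ ha₄ h2 hζ hσζ) ℓ hK

end Descent

end JZero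

section ModelTransport

variable {X X' : WeierstrassCurve ℚ} [X.IsElliptic] [X'.IsElliptic]

/-- **MODEL TRANSPORT**: `ℚ`-isomorphic models have the same `#Ш[ℓ^∞]` — a change of
variables `C` with `C • X = X'` is an isogeny of degree `1` (`VariableChange.toIsogeny`,
`degree_toIsogeny`), and `#Ш[ℓ^∞]` is invariant along isogenies of degree prime to `ℓ`
(`Isogeny.natCard_primaryComponent_sha_eq`). (Use: globally minimal models `B`, `A` with
`C • B = cubeSumCurve p`, `C • A = cubeSumCurve (3p²)`, `HuShuYin2019.cubeSumCurve`.)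
[cite: MilneADT2006, Ch. I Lemma 7.1(b) (proof), p. 96] [cite: SilvermanAEC2009, III.3.1(b)] -/
theorem natCard_primaryComponent_sha_eq_of_variableChange {C : VariableChange ℚ}
    (hC : C • X = X') (ℓ : ℕ) [Fact ℓ.Prime] :
    Nat.card (AddCommGroup.primaryComponent X.sha ℓ) =
      Nat.card (AddCommGroup.primaryComponent X'.sha ℓ) := by
  subst hC
  exact (VariableChange.toIsogeny X C).natCard_primaryComponent_sha_eq ℓ
    (by rw [VariableChange.degree_toIsogeny]; exact (Fact.out : ℓ.Prime).not_dvd_one)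

/-- **The assembled descent**: for a `ℚ`-model `X` with
`C • X = ⟨0, 0, 0, 0, b⟩` (e.g. `X` a globally minimal model of `E_p` or `E_{3p²}` and
`⟨0,0,0,0,b⟩ = cubeSumCurve _`, by `rfl`), a quadratic number field `K ∋ ζ` (`ζ` a primitive cube
root of unity) and `σ ∈ Aut(K/ℚ)` with `σ ζ = ζ²`: if `Ш(⟨0,0,0,0,b⟩_K / K)[ℓ^∞]` is trivial then
`#Ш(X/ℚ)[ℓ^∞] = 1` (with `ℓ = 2`: a `2`-descent over `K = ℚ(ω)` showing `Ш(X_K/K)[2^∞] = 0`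
gives `Ш(X/ℚ)[2^∞] = 0` for every `ℚ`-model of the curve).
[cite: GrossLMS1991, §5 (5.1)] [cite: MilneADT2006, Ch. I Lemma 7.1(b), p. 96] -/
theorem JZero.natCard_primaryComponent_sha_eq_one_of_variableChange_of_baseChange {b : ℚ}
    {C : VariableChange ℚ} (hC : C • X = ⟨0, 0, 0, 0, b⟩) (K : Type) [Field K] [NumberField K]
    (h2 : Module.finrank ℚ K = 2) {ζ : K} (hζ : IsPrimitiveRoot ζ 3) {σ : K ≃ₐ[ℚ] K}
    (hσζ : σ ζ = ζ ^ 2) (ℓ : ℕ) [Fact ℓ.Prime]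
    (hK : Nat.card (AddCommGroup.primaryComponent
      ((⟨0, 0, 0, 0, b⟩ : WeierstrassCurve ℚ).baseChange K).sha ℓ) = 1) :
    Nat.card (AddCommGroup.primaryComponent X.sha ℓ) = 1 := by
  haveI : (⟨0, 0, 0, 0, b⟩ : WeierstrassCurve ℚ).IsElliptic := hC ▸ inferInstance
  rw [natCard_primaryComponent_sha_eq_of_variableChange hC ℓ]
  exact JZero.natCard_primaryComponent_sha_eq_one_of_baseChange ⟨0, 0, 0, 0, b⟩ K rfl rfl rfl rfl h2
    hζ hσζ ℓ hK

end ModelTransport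

/-! ## §5 Restriction lands in the `τ_*`-invariants -/

section Invariants

variable (W : WeierstrassCurve ℚ) (K : Type) [Field K] [NumberField K]
variable {σ : K ≃ₐ[ℚ] K} {τ : AlgebraicClosure K ≃+* AlgebraicClosure K}

/-- The coefficient map of `resBaseChange` on an affine point: `E(ℚ̄) → E_K(K̄)` is the chosen
embedding `ι : ℚ̄ → K̄` on coordinates (`pointsMap` = `Point.map ι`, then the identification
`localPointsEquivGeomPoints`, the identity on coordinates). [folklore] -/
private theorem localPointsEquivGeomPoints_pointsMap_some {x y : AlgebraicClosure ℚ}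
    (h : (W.baseChange (AlgebraicClosure ℚ)).toAffine.Nonsingular x y) :
    ∃ h', localPointsEquivGeomPoints W K (pointsMap W K (Affine.Point.some x y h)) =
      Affine.Point.some (closureEmb (K := ℚ) K x) (closureEmb (K := ℚ) K y) h' := by
  obtain ⟨h₁, e₁⟩ : ∃ h₁, pointsMap W K (Affine.Point.some x y h : geomPoints W) =
      (Affine.Point.some (closureEmb (K := ℚ) K x) (closureEmb (K := ℚ) K y) h₁ :
        localPoints W K) := ⟨_, rfl⟩
  refine ⟨(baseChange_baseChange W K (AlgebraicClosure K)).symm ▸ h₁, ?_⟩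
  rw [e₁]
  simp only [localPointsEquivGeomPoints, pointsCongr]
  exact Affine.Point.congrEquiv_some _ h₁

/-- **`τ_* ∘ res = res`**: for `E = W/ℚ`, any number field `K`, any `σ ∈ Aut(K/ℚ)`
and any lift `τ` of `σ` to `K̄`, the action `τ_*` (`IsLiftOfAut.conjH1Points`) fixes every
restricted class: `τ_* (res c) = res c` for `c ∈ H¹(ℚ, E)`. Proof: with `e : ℚ̄ ≃ K̄` the chosen
isomorphism and `γ := e⁻¹ τ e ∈ Γ_ℚ`, the compatible pair of `τ_* ∘ res` is the pair of `res`
precomposed with the INNER pair `(g ↦ γ⁻¹ g γ, P ↦ γ P)` of `Γ_ℚ`, which acts trivially on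
`H¹(ℚ, E)` (the tree's `map_one_eq_of_conj_comp`, Serre VII.§5 Prop. 3). Hence `res` maps
`H¹(ℚ, E)` — in particular `Ш(E/ℚ)` — into the `Gal(K/ℚ)`-invariants. Gross 1991 §5 (5.1)
(«`Ш(E/K)^±`»).
[cite: SerreLocalFields1979, VII.§5 Prop. 3] [cite: GrossLMS1991, §5 (5.1)] -/
theorem conjH1Points_resBaseChange (hτ : IsLiftOfAut σ τ) (c : W.galH1) :
    hτ.conjH1Points W (resBaseChange W K c) = resBaseChange W K c := by
  -- the element `γ = e⁻¹ τ e` of `Γ_ℚ`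
  let γ : Field.absoluteGaloisGroup ℚ :=
    show AlgebraicClosure ℚ ≃ₐ[ℚ] AlgebraicClosure ℚ from
      ((algEquivOfEmb K (closureEmb (K := ℚ) K)).trans hτ.algEquiv).trans
        (algEquivOfEmb K (closureEmb (K := ℚ) K)).symm
  have hγ : ∀ z, (show AlgebraicClosure ℚ ≃ₐ[ℚ] AlgebraicClosure ℚ from γ) z =
      (algEquivOfEmb K (closureEmb (K := ℚ) K)).symm
        (τ (algEquivOfEmb K (closureEmb (K := ℚ) K) z)) := fun z ↦ rfl
  have hγinv : ∀ w, (show AlgebraicClosure ℚ ≃ₐ[ℚ] AlgebraicClosure ℚ from γ⁻¹) w =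
      (algEquivOfEmb K (closureEmb (K := ℚ) K)).symm
        (τ.symm (algEquivOfEmb K (closureEmb (K := ℚ) K) w)) := fun w ↦ rfl
  -- the two compatible pairs `H¹(Γ_ℚ, E(ℚ̄)) → H¹(Γ_K, E_K(K̄))`
  let Φ : Field.absoluteGaloisGroup K →ₜ* Field.absoluteGaloisGroup ℚ :=
    (resGal (K := ℚ) K).comp (ContinuousMonoidHom.id _)
  let Ψ : geomPoints W →+ geomPoints (W.baseChange K) :=
    ((localPointsEquivGeomPoints W K : localPoints W K ≃+ geomPoints (W.baseChange K)) :
      localPoints W K →+ geomPoints (W.baseChange K)).comp (pointsMap W K)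
  have hΨ : ∀ (g : Field.absoluteGaloisGroup K) (P : geomPoints W), Ψ (Φ g • P) = g • Ψ P := by
    intro g P
    change localPointsEquivGeomPoints W K (pointsMap W K (resGal (K := ℚ) K g • P)) =
      g • localPointsEquivGeomPoints W K (pointsMap W K P)
    rw [pointsMap_smul, localPointsEquivGeomPoints_smul]
  have hΨ' : ∀ (g : Field.absoluteGaloisGroup K) (P : geomPoints W),
      ((hτ.pointsMap W).comp Ψ) ((Φ.comp hτ.conjGalCMH) g • P) =
        g • ((hτ.pointsMap W).comp Ψ) P := by
    intro g P
    change hτ.pointsMap W (Ψ (Φ (hτ.conjGalCMH g) • P)) = g • hτ.pointsMap W (Ψ P)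
    rw [hΨ, hτ.pointsMap_smul W]
  -- (hφ) `res (τ⁻¹ g τ) = γ⁻¹ (res g) γ`
  have hφ : Φ.comp hτ.conjGalCMH = (conjCMH γ).comp Φ := by
    apply ContinuousMonoidHom.ext
    intro g
    change resGal (K := ℚ) K (hτ.conjGalCMH g) = γ⁻¹ * resGal (K := ℚ) K g * γ
    apply AlgEquiv.ext
    intro z
    apply (algEquivOfEmb K (closureEmb (K := ℚ) K)).injective
    have lhs : algEquivOfEmb K (closureEmb (K := ℚ) K)
        ((show AlgebraicClosure ℚ ≃ₐ[ℚ] AlgebraicClosure ℚ from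
          resGal (K := ℚ) K (hτ.conjGalCMH g)) z) =
        τ.symm ((show AlgebraicClosure K ≃ₐ[K] AlgebraicClosure K from g)
          (τ (algEquivOfEmb K (closureEmb (K := ℚ) K) z))) :=
      (algEquivOfEmb_resGal_apply (K := ℚ) K (hτ.conjGalCMH g) z).trans rfl
    have rhs : algEquivOfEmb K (closureEmb (K := ℚ) K)
        ((show AlgebraicClosure ℚ ≃ₐ[ℚ] AlgebraicClosure ℚ from
          (γ⁻¹ * resGal (K := ℚ) K g * γ)) z) =
        τ.symm ((show AlgebraicClosure K ≃ₐ[K] AlgebraicClosure K from g)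
          (τ (algEquivOfEmb K (closureEmb (K := ℚ) K) z))) := by
      change algEquivOfEmb K (closureEmb (K := ℚ) K)
          ((show AlgebraicClosure ℚ ≃ₐ[ℚ] AlgebraicClosure ℚ from γ⁻¹)
            ((show AlgebraicClosure ℚ ≃ₐ[ℚ] AlgebraicClosure ℚ from resGal (K := ℚ) K g)
              ((show AlgebraicClosure ℚ ≃ₐ[ℚ] AlgebraicClosure ℚ from γ) z))) = _
      have step : algEquivOfEmb K (closureEmb (K := ℚ) K)
          ((show AlgebraicClosure ℚ ≃ₐ[ℚ] AlgebraicClosure ℚ from resGal (K := ℚ) K g)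
            ((show AlgebraicClosure ℚ ≃ₐ[ℚ] AlgebraicClosure ℚ from γ) z)) =
          (show AlgebraicClosure K ≃ₐ[K] AlgebraicClosure K from g)
            (algEquivOfEmb K (closureEmb (K := ℚ) K)
              ((show AlgebraicClosure ℚ ≃ₐ[ℚ] AlgebraicClosure ℚ from γ) z)) :=
        algEquivOfEmb_resGal_apply (K := ℚ) K g _
      rw [hγinv, AlgEquiv.apply_symm_apply, step, hγ, AlgEquiv.apply_symm_apply]
    exact lhs.trans rhs.symm
  -- (hψ) `τ (ι P) = ι (γ P)` on `E(ℚ̄)`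
  have hψ : (hτ.pointsMap W).comp Ψ = Ψ.comp (DistribSMul.toAddMonoidHom (geomPoints W) γ) := by
    apply AddMonoidHom.ext
    intro P
    change hτ.pointsMap W (Ψ P) = Ψ (γ • P)
    change (W.baseChange (AlgebraicClosure ℚ)).toAffine.Point at P
    rcases P with _ | ⟨x, y, h⟩
    · change hτ.pointsMap W (Ψ 0) = Ψ (γ • (0 : geomPoints W))
      rw [smul_zero, map_zero, map_zero]
    · obtain ⟨hγP, eγP⟩ := JZero.geomPoints_smul_some_eq W γ h
      obtain ⟨h₁, e₁⟩ := localPointsEquivGeomPoints_pointsMap_some W K h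
      obtain ⟨h₂, e₂⟩ := localPointsEquivGeomPoints_pointsMap_some W K hγP
      change hτ.pointsMap W (localPointsEquivGeomPoints W K (pointsMap W K (Affine.Point.some x y h)))
        = localPointsEquivGeomPoints W K (pointsMap W K
          (@HSMul.hSMul (Field.absoluteGaloisGroup ℚ) (geomPoints W) (geomPoints W) instHSMul γ
            (Affine.Point.some x y h)))
      rw [eγP, e₁, e₂]
      refine Affine.Point.some_eq_some_of_eq ?_ ?_
      · change τ (algEquivOfEmb K (closureEmb (K := ℚ) K) x) =
          algEquivOfEmb K (closureEmb (K := ℚ) K)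
            ((show AlgebraicClosure ℚ ≃ₐ[ℚ] AlgebraicClosure ℚ from γ) x)
        rw [hγ, AlgEquiv.apply_symm_apply]
      · change τ (algEquivOfEmb K (closureEmb (K := ℚ) K) y) =
          algEquivOfEmb K (closureEmb (K := ℚ) K)
            ((show AlgebraicClosure ℚ ≃ₐ[ℚ] AlgebraicClosure ℚ from γ) y)
        rw [hγ, AlgEquiv.apply_symm_apply]
  -- assemble: both sides are maps of compatible pairs differing by the inner pair of `γ`
  change hτ.conjH1Points W (h1Equiv (localPointsEquivGeomPoints W K)
    (localPointsEquivGeomPoints_smul W K)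
    (resH1Hom (resGal (K := ℚ) K) (pointsMap W K) (pointsMap_smul W K) c)) =
    h1Equiv (localPointsEquivGeomPoints W K) (localPointsEquivGeomPoints_smul W K)
      (resH1Hom (resGal (K := ℚ) K) (pointsMap W K) (pointsMap_smul W K) c)
  rw [h1Equiv_apply, resH1Hom_resH1Hom]
  unfold IsLiftOfAut.conjH1Points
  rw [resH1Hom_resH1Hom]
  unfold resH1Hom
  rw [map_one_eq_of_conj_comp Φ Ψ hΨ γ hΨ' hφ hψ]

/-- **`Ш(E/ℚ)` restricts into `Ш(E_K/K)^{Gal(K/ℚ)}`**: on the tree's `Ш`, `τ_* (res c) = res c`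
(`conjH1Points_resBaseChange` under the coercions of `shaRestriction`).
[cite: GrossLMS1991, §5 (5.1)] -/
theorem conjH1Points_shaRestriction (hτ : IsLiftOfAut σ τ) (c : W.sha) :
    hτ.conjH1Points W (shaRestriction W K c : (W.baseChange K).galH1) = shaRestriction W K c := by
  rw [coe_shaRestriction_apply, conjH1Points_resBaseChange]

end Invariants


/-! ## §6 The binder convention `(K, ω, ω² + ω + 1 = 0, [K : ℚ] = 2)`: discharging `ζ`, `σ`, `τ` -/

namespace JZero

open NumberField Literature.NumberTheory.QuadraticFields

variable (K : Type) [Field K] [NumberField K]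

/-- `ω² + ω + 1 = 0` makes `ω` a primitive cube root of unity (characteristic `0`). [folklore] -/
private theorem isPrimitiveRoot_of_sq_add_self_add_one {ω : K} (hω : ω ^ 2 + ω + 1 = 0) :
    IsPrimitiveRoot ω 3 := by
  refine (IsPrimitiveRoot.iff (by norm_num)).mpr ⟨by linear_combination (ω - 1) * hω, ?_⟩
  intro l hl0 hl3 h
  interval_cases l
  · rw [pow_one] at h
    rw [h] at hω
    norm_num at hω
  · have h2 : ω = -2 := by linear_combination hω - h
    rw [h2] at hω
    norm_num at hω

/-- `θ := 2ω + 1` satisfies `θ² = −3`. [folklore] -/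
private theorem sq_two_mul_add_one {ω : K} (hω : ω ^ 2 + ω + 1 = 0) :
    (2 * ω + 1) ^ 2 = algebraMap ℚ K (-3) := by
  rw [map_neg, map_ofNat]
  linear_combination 4 * hω

/-- `θ = 2ω + 1 ∉ ℚ` (`−3` is not a rational square). [folklore] -/
private theorem two_mul_add_one_not_mem {ω : K} (hω : ω ^ 2 + ω + 1 = 0) :
    2 * ω + 1 ∉ Set.range (algebraMap ℚ K) := by
  rintro ⟨q, hq⟩
  have h := sq_two_mul_add_one K hω
  rw [← hq, ← map_pow] at h
  have h' : q ^ 2 = -3 := (algebraMap ℚ K).injective h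
  nlinarith [sq_nonneg q]

/-- A number field containing `ω` with `ω² + ω + 1 = 0` is totally complex (a real embedding would
send `2ω + 1` to a real square root of `−3`). [folklore] -/
private theorem isComplex_of_sq_add_self_add_one {ω : K} (hω : ω ^ 2 + ω + 1 = 0)
    (w : InfinitePlace K) : w.IsComplex := by
  rw [← InfinitePlace.not_isReal_iff_isComplex]
  intro hw
  have h : ((InfinitePlace.embedding_of_isReal hw (2 * ω + 1) : ℝ) : ℂ) ^ 2 = -3 := by
    rw [InfinitePlace.embedding_of_isReal_apply, ← map_pow, sq_two_mul_add_one K hω, map_neg,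
      map_ofNat, map_neg, map_ofNat]
  have h' : (InfinitePlace.embedding_of_isReal hw (2 * ω + 1) : ℝ) ^ 2 = -3 := by exact_mod_cast h
  nlinarith [sq_nonneg (InfinitePlace.embedding_of_isReal hw (2 * ω + 1))]

/-- **Complex conjugation on `K = ℚ(ω)`.** For a number field `K` with `[K : ℚ] = 2` and
`ω ∈ K`, `ω² + ω + 1 = 0` (the binder convention of Hu–Shu–Yin's display,
`HuShuYin2019.shaAnPair_mul_height_eq_two_zpow_mul_height`): `ω` is a primitive cube root of
unity, there is `σ ∈ Aut(K/ℚ)` with `σ ω = ω²` and `σ² = 1` (the conjugation `a + bθ ↦ a − bθ`,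
`θ = 2ω + 1 = √−3`, of `QuadraticFields.Quadratic.conj`), and every infinite place of `K` is complex.
These are the standing hypotheses (`hζ`, `hσζ`, `hσ2`, `hK`) of the descent theorems above and of
the `ℤ[ω]`-module / square-law bricks over `K`. [cite: HuShuYin2019, §1 (K = ℚ(√−3), ω)] -/
theorem exists_aut_apply_eq_sq {ω : K} (hω : ω ^ 2 + ω + 1 = 0) (h2 : Module.finrank ℚ K = 2) :
    IsPrimitiveRoot ω 3 ∧ (∀ w : InfinitePlace K, w.IsComplex) ∧
      ∃ σ : K ≃ₐ[ℚ] K, σ ω = ω ^ 2 ∧ σ * σ = 1 := by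
  refine ⟨isPrimitiveRoot_of_sq_add_self_add_one K hω, isComplex_of_sq_add_self_add_one K hω, ?_⟩
  have hθ := two_mul_add_one_not_mem K hω
  have hc := sq_two_mul_add_one K hω
  let σ : K ≃ₐ[ℚ] K :=
    AlgEquiv.ofAlgHom (Quadratic.conj h2 hθ hc) (Quadratic.conj h2 hθ hc)
      (AlgHom.ext fun x ↦ Quadratic.conj_conj h2 hθ hc x)
      (AlgHom.ext fun x ↦ Quadratic.conj_conj h2 hθ hc x)
  have hσθ : σ (2 * ω + 1) = -(2 * ω + 1) := Quadratic.conj_gen h2 hθ hc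
  refine ⟨σ, ?_, AlgEquiv.ext fun x ↦ Quadratic.conj_conj h2 hθ hc x⟩
  have e : (2 : K) * σ ω = 2 * (-ω - 1) := by
    have h1 : σ (2 * ω + 1) = 2 * σ ω + 1 := by
      rw [map_add, map_mul, map_one, map_ofNat]
    linear_combination hσθ - h1
  have e' : σ ω = -ω - 1 := mul_left_cancel₀ two_ne_zero e
  rw [e']
  linear_combination -hω

/-- **`Ш(E/ℚ) ↪ Ш(E_K/K)`, binder form**: `E = W/ℚ` an elliptic `j = 0` short model, `K` a number
field with `[K : ℚ] = 2` and `ω ∈ K`, `ω² + ω + 1 = 0` — then `shaRestriction W K` is injective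
(`shaRestriction_injective_of_isPrimitiveRoot` with `exists_aut_apply_eq_sq`).
[cite: GrossLMS1991, §5 (5.1)] [cite: SilvermanAEC2009, Thm. III.10.1 and Cor. III.10.2] -/
theorem shaRestriction_injective (W : WeierstrassCurve ℚ) [W.IsElliptic] (ha₁ : W.a₁ = 0)
    (ha₂ : W.a₂ = 0) (ha₃ : W.a₃ = 0) (ha₄ : W.a₄ = 0) {ω : K} (hω : ω ^ 2 + ω + 1 = 0)
    (h2 : Module.finrank ℚ K = 2) : Function.Injective (shaRestriction W K) := by
  obtain ⟨hζ, -, σ, hσζ, -⟩ := exists_aut_apply_eq_sq K hω h2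
  exact shaRestriction_injective_of_isPrimitiveRoot W K ha₁ ha₂ ha₃ ha₄ h2 hζ hσζ

/-- **The assembled descent, binder form**: for a `ℚ`-model `X` with `C • X = ⟨0, 0, 0, 0, b⟩`
(e.g. `⟨0,0,0,0,b⟩ = HuShuYin2019.cubeSumCurve n` by `rfl`), a number field `K` with `[K : ℚ] = 2`
and `ω ∈ K`, `ω² + ω + 1 = 0`, and a prime `ℓ`: `#Ш(⟨0,0,0,0,b⟩_K/K)[ℓ^∞] = 1 ⇒ #Ш(X/ℚ)[ℓ^∞] = 1`.
[cite: GrossLMS1991, §5 (5.1)] [cite: MilneADT2006, Ch. I Lemma 7.1(b), p. 96] -/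
theorem natCard_primaryComponent_sha_eq_one_of_variableChange {X : WeierstrassCurve ℚ}
    [X.IsElliptic] {b : ℚ} {C : VariableChange ℚ} (hC : C • X = ⟨0, 0, 0, 0, b⟩) {ω : K}
    (hω : ω ^ 2 + ω + 1 = 0) (h2 : Module.finrank ℚ K = 2) (ℓ : ℕ) [Fact ℓ.Prime]
    (hK : Nat.card (AddCommGroup.primaryComponent
      ((⟨0, 0, 0, 0, b⟩ : WeierstrassCurve ℚ).baseChange K).sha ℓ) = 1) :
    Nat.card (AddCommGroup.primaryComponent X.sha ℓ) = 1 := by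
  obtain ⟨hζ, -, σ, hσζ, -⟩ := exists_aut_apply_eq_sq K hω h2
  exact natCard_primaryComponent_sha_eq_one_of_variableChange_of_baseChange hC K h2 hζ hσζ ℓ hK

end JZero

end Literature.NumberTheory.EllipticCurves

end
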